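import Summits.AnomalousDissipation.AnomalousDissipation.Theorems.BaireTransferRobustLoudUpgradeWildResidual

/-!
# Line `malkin-cone-group-orbits`, reshape c14 ("THE DESIGNER SEGMENT INSIDE `P_S`"): the polynomial-witness steady class
# `polySteady`, the tame union `tamePoly`, and the line glue (crux `BaireTransfer.RobustLoudUpgrade`, stmt-AnomalousDissipation-1144)

Definitions + glue (reviewed for the two definitions; the glue is pure topology over the landed
`Unfolding.tameUnfold_subset_closure_interior_loud`, p131399, and `WildResidual.*`, p132214).

The strategist census of this crux (`Cruxes/RobustLoudUpgrade/STRATEGY-CENSUS.md`, T1) records the two-line proof of the steady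
upgrade in the INFINITE-dimensional force space — the designer segment `u_t = t·u₀`, `f_t = t²f₀ + (t − t²)ν Au₀` through a steady
witness `(u₀, f₀, ν)`, along which the linearisation `νA + t·DB(u₀)` is an analytic (indeed affine) compact perturbation of an
invertible operator, hence invertible off a discrete set of `t` — and its break point in a finite family: `f_t ∈ F_S` iff
`Au₀ ∈ F_S`.  The class below is EXACTLY the set of loud steady witnesses at which the segment stays inside `P_S`:

* `polySteady S a E ε` (any mean, strict budgets): `c` carries, at some `ν ∈ (0,a)`, a classical steady state `u₀` of `NS_ν(f_c)`
  with `meanEnergy < E`, `meanDissipation > ε` and `Δu₀ = f_e` for some `e ∈ P_S` — i.e. an exact trigonometric-polynomial steady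
  state with spectrum in `S ∪ −S`: Kolmogorov and every parallel shear profile in `S` (drifted or not), single-shell cellular flows,
  Beltrami/ABC flows; every explicit loud witness in this crux's record (`Cruxes/…/Disproof.lean` §6, `Negative/GalileanDrift`) and
  every seed family of the census's proposed computation N-e.  Along the segment the forces are `γ t = t²c + (t² − t)ν e ∈ P_S`,
  the states `t•u₀` are exact steady states at the SAME viscosity, and (Riesz–Schauder on the drifted Fourier lattice of
  `Literature.Analysis.FluidPDE.SteadyLattice(Drift)`) only finitely many `t ∈ [½, 2]` are degenerate, so `γ t ∈ nondegSteadyLeaf ⊆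
  interior LOUD` for `t → 1` off a finite set: `polySteady ⊆ closure (interior loud)` with NO visibility, nondegeneracy or symmetry
  hypothesis (proved in the lead's skeleton `Cruxes/RobustLoudUpgrade/Lines/malkin_cone_group_orbits_c14.lean` from four registered
  stubs; it is the hypothesis `hP` of the glue here until those land).
* `tamePoly := tameUnfold ∪ polySteady` and the glue: `line_glue_c14 : hP → (wild residual over tamePoly) → RobustLoudUpgrade`;
  `residual_c14_of_c6` (the registered c6 residual implies the c14 residual — nothing registered is lost); `residual_c14_of_crux`.

References: Foias–Temam 1977 §1 and Saut–Temam 1980 §2 (regular points of the steady map); Temam 1979 Ch. II §1; Rudin,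
*Functional Analysis* Thm. 4.24–4.25 (Riesz–Schauder); the route file `Theses/BaireTransfer.lean` (item 1144);
`Cruxes/RobustLoudUpgrade/STRATEGY-CENSUS.md` (T1, R3).
-/

-- `Summit.<Summit>.<Problem>` is the tree's mandated summit-side namespace (CONVENTIONS §2); for this
-- single-conjunct summit the two coincide, so the duplicate is deliberate.
set_option linter.dupNamespace false

noncomputable section

open scoped BigOperators Topology
open Filter Set Function TopologicalSpace MeasureTheory

namespace Summit.AnomalousDissipation.AnomalousDissipation.Theorems.RobustLoudUpgrade

open Literature.Analysis.FunctionSpaces Literature.Analysis.FunctionSpaces.Torus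
open Literature.Analysis.FluidPDE
open Summit.AnomalousDissipation.AnomalousDissipation.Theses.BaireTransfer
open Summit.AnomalousDissipation.AnomalousDissipation.Theorems.RobustLoudUpgrade.Unfolding
open Summit.AnomalousDissipation.AnomalousDissipation.Theorems.RobustLoudUpgrade.WildResidual

namespace Poly

/-! ## §1 The two definitions of the reshape c14 -/

/-- **Polynomial loud steady witnesses** (any mean, strict budgets): `c` carries, at some `ν ∈ (0,a)`, a classical steady state `u₀`
of `NS_ν(f_c)` with `meanEnergy < E`, `meanDissipation > ε`, whose Laplacian is itself a force of the family, `Δu₀ = f_e` for some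
`e ∈ P_S` (an exact trigonometric-polynomial steady state with spectrum in `S ∪ −S`), so that the designer segment
`t ↦ t²c + (t² − t)ν e` of the forces carrying the exact steady states `t•u₀` stays inside `P_S`
(Foias–Temam 1977 §1; census T1). [folklore] -/
def polySteady (S : Finset (Fin 3 → ℤ)) (a E ε : ℝ) : Set (Coeff S) :=
  {c | ∃ ν : ℝ, 0 < ν ∧ ν < a ∧ ∃ (u₀ : UnitAddTorus (Fin 3) → EuclideanSpace ℝ (Fin 3)) (p₀ : UnitAddTorus (Fin 3) → ℝ),
    Torus.IsSteadyNSState ν (force S c) u₀ p₀ ∧ meanEnergy (fun _ : ℝ => u₀) < E ∧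
      ε < meanDissipation ν (fun _ : ℝ => u₀) ∧ ∃ e : Coeff S, ∀ x, laplacian u₀ x = force S e x}

/-- **The tame union of the reshape c14**: the maximal landed tame union `tameUnfold` (companions v2–c5) plus the polynomial steady
class. [folklore] -/
def tamePoly (S : Finset (Fin 3 → ℤ)) (a E ε : ℝ) : Set (Coeff S) :=
  tameUnfold S a E ε ∪ polySteady S a E ε

/-! ## §2 Glue (sorry-free, pure topology) -/

/-- `tameUnfold ⊆ tamePoly`. [folklore] -/
theorem tameUnfold_subset_tamePoly (S : Finset (Fin 3 → ℤ)) (a E ε : ℝ) : tameUnfold S a E ε ⊆ tamePoly S a E ε :=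
  Set.subset_union_left

/-- `polySteady ⊆ tamePoly`. [folklore] -/
theorem polySteady_subset_tamePoly (S : Finset (Fin 3 → ℤ)) (a E ε : ℝ) : polySteady S a E ε ⊆ tamePoly S a E ε :=
  Set.subset_union_right

/-- The tame union of the reshape is force-open up to closure, given the class theorem for `polySteady`. [folklore] -/
theorem tamePoly_subset_closure_interior_loud_of
    (hP : ∀ (S : Finset (Fin 3 → ℤ)) (a E ε : ℝ), polySteady S a E ε ⊆ closure (interior (loud S a E ε)))
    (S : Finset (Fin 3 → ℤ)) (a E ε : ℝ) : tamePoly S a E ε ⊆ closure (interior (loud S a E ε)) :=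
  Set.union_subset (tameUnfold_subset_closure_interior_loud S a E ε) (hP S a E ε)

/-- **Nothing registered is lost**: the registered c6 residual (`WildResidual.stub_residual_c6`, the wild residual over `tameUnfold`)
implies the c14 residual (the wild residual over `tamePoly ⊇ tameUnfold`). [folklore] -/
theorem residual_c14_of_c6
    (h6 : ∃ S₀ : Finset (Fin 3 → ℤ), ∀ S : Finset (Fin 3 → ℤ), S₀ ⊆ S → ∀ (E ε : ℝ), 0 < ε → ∀ j : ℕ,
      loud S (1 / ((j : ℝ) + 1)) E ε \ closure (tameUnfold S (1 / ((j : ℝ) + 1)) (2 * E) (ε / 2)) ⊆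
        closure (interior (loud S (1 / ((j : ℝ) + 1)) (2 * E) (ε / 2)))) :
    ∃ S₀ : Finset (Fin 3 → ℤ), ∀ S : Finset (Fin 3 → ℤ), S₀ ⊆ S → ∀ (E ε : ℝ), 0 < ε → ∀ j : ℕ,
      loud S (1 / ((j : ℝ) + 1)) E ε \ closure (tamePoly S (1 / ((j : ℝ) + 1)) (2 * E) (ε / 2)) ⊆
        closure (interior (loud S (1 / ((j : ℝ) + 1)) (2 * E) (ε / 2))) := by
  obtain ⟨S₀, h⟩ := h6
  refine ⟨S₀, fun S hS E ε hε j c hc => h S hS E ε hε j ⟨hc.1, fun hcl => hc.2 ?_⟩⟩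
  exact closure_mono (tameUnfold_subset_tamePoly S _ _ _) hcl

/-- The crux implies the c14 residual (with the crux's own stock). [folklore] -/
theorem residual_c14_of_crux (h : RobustLoudUpgrade) :
    ∃ S₀ : Finset (Fin 3 → ℤ), ∀ S : Finset (Fin 3 → ℤ), S₀ ⊆ S → ∀ (E ε : ℝ), 0 < ε → ∀ j : ℕ,
      loud S (1 / ((j : ℝ) + 1)) E ε \ closure (tamePoly S (1 / ((j : ℝ) + 1)) (2 * E) (ε / 2)) ⊆
        closure (interior (loud S (1 / ((j : ℝ) + 1)) (2 * E) (ε / 2))) :=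
  residual_c14_of_c6 (wild_of_RobustLoudUpgrade h)

/-- **Line glue of the reshape c14 (registered sub-goal `line_glue_c14`)**: the class theorem for `polySteady` and the wild residual
over `tamePoly` (the registered `Poly.stub_residual_c14` of the skeleton `Lines/malkin_cone_group_orbits_c14.lean`) prove the crux
`RobustLoudUpgrade` BY NAME (`WildResidual.subset_closure_interior_of_diff`). [folklore] -/
theorem line_glue_c14 : (∀ (S : Finset (Fin 3 → ℤ)) (a E ε : ℝ), polySteady S a E ε ⊆ closure (interior (loud S a E ε))) → (∃ S₀ : Finset (Fin 3 → ℤ), ∀ S : Finset (Fin 3 → ℤ), S₀ ⊆ S → ∀ (E ε : ℝ), 0 < ε → ∀ j : ℕ, loud S (1 / ((j : ℝ) + 1)) E ε \ closure (tamePoly S (1 / ((j : ℝ) + 1)) (2 * E) (ε / 2)) ⊆ closure (interior (loud S (1 / ((j : ℝ) + 1)) (2 * E) (ε / 2)))) → RobustLoudUpgrade := by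
  rintro hP ⟨S₀, h⟩
  exact ⟨S₀, fun S hS E ε hε j =>
    subset_closure_interior_of_diff (tamePoly_subset_closure_interior_loud_of hP S _ _ _) (h S hS E ε hε j)⟩

/-- Given the class theorem, the crux is EQUIVALENT to the c14 residual (as for c6: the reshape neither loses nor over-claims).
[folklore] -/
theorem RobustLoudUpgrade_iff_residual_c14
    (hP : ∀ (S : Finset (Fin 3 → ℤ)) (a E ε : ℝ), polySteady S a E ε ⊆ closure (interior (loud S a E ε))) :
    RobustLoudUpgrade ↔
      ∃ S₀ : Finset (Fin 3 → ℤ), ∀ S : Finset (Fin 3 → ℤ), S₀ ⊆ S → ∀ (E ε : ℝ), 0 < ε → ∀ j : ℕ,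
        loud S (1 / ((j : ℝ) + 1)) E ε \ closure (tamePoly S (1 / ((j : ℝ) + 1)) (2 * E) (ε / 2)) ⊆
          closure (interior (loud S (1 / ((j : ℝ) + 1)) (2 * E) (ε / 2))) :=
  ⟨residual_c14_of_crux, line_glue_c14 hP⟩

end Poly

end Summit.AnomalousDissipation.AnomalousDissipation.Theorems.RobustLoudUpgrade

end
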